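import Summits.AnomalousDissipation.AnomalousDissipation.Theses.LandauJetArena
import Literature.Analysis.FluidPDE.HomogeneousEulerProofs

/-!
# AnomalousDissipation / LandauJetArena — support item `NoConicalEulerFlux`: the `C¹` case

Route `AnomalousDissipation/LandauJetArena`, item stmt-AnomalousDissipation-1547
(`NoConicalEulerFlux`, support, rank 9): a `(-1)`-homogeneous stationary weak Euler pair `(U, P)`
on `ℝ³ ∖ {0}` which is merely CONTINUOUS off the origin carries no momentum flux through
spheres, `∫ (⟪U, ∇χ̃⟫ U + P ∇χ̃) dx = 0` for every smooth radial cut-off `χ̃ = χ ∘ ‖·‖`.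

This file proves the `C¹` SHADOW of the item (helper, `--supports`): the same statement with
`ContinuousOn` strengthened to `ContDiffOn ℝ 1` for both `U` and `P`
(`noConicalEulerFlux_of_contDiffOn`). Proof:

* weak ⇒ strong off the origin (`divergence_eq_zero_of_weak`, `momentum_eq_zero_of_weak`): the
  weak identities are integrated by parts against fields compactly supported in `ℝ³ ∖ {0}`
  (`Literature.Analysis.FluidPDE.Shvydkoy2018.integral_fderiv_apply_add_mul_divergence_eq_zero`)
  and the du Bois-Reymond lemma (`IsOpen.ae_eq_zero_of_integral_contDiff_smul_eq_zero`) plus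
  continuity give `div U = 0` and `(U·∇)U + ∇P = 0` pointwise on `{x ≠ 0}`;
* Shvydkoy 2018, Prop. 2.1, PROVED in the tree
  (`Literature.Analysis.FluidPDE.shvydkoy_homogeneousSteadyEuler_alpha_one_holds`): a `C¹`
  homogeneous stationary Euler pair at the Landau scaling vanishes off the origin, and the
  homogeneity clauses at `x = 0` force `U 0 = 0`, `P 0 = 0`; so the flux integrand is
  identically zero.

What is NOT here: the `C⁰` statement of the item itself. Its content is exactly the gap
`C⁰ ∖ C¹`: every identity obtainable by testing the weak equations is blind to the flux (the
`⟪U, x/‖x‖⟫²` moment of the flux never appears in a tested identity), and the printed proofs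
(Shvydkoy 2018 Prop. 2.1; Abe 2023 Thm 2.4) test the equations with the solution itself, which
needs `C¹` (see the evidence note attached to the item).
-/

-- `Summit.<Summit>.<Problem>` is the tree's mandated summit-side namespace (CONVENTIONS §2); for
-- this single-conjunct summit the two coincide, so the duplicate is deliberate.
set_option linter.dupNamespace false

noncomputable section

namespace Summit.AnomalousDissipation.AnomalousDissipation.Theorems

open MeasureTheory Set Filter
open scoped InnerProductSpace RealInnerProductSpace Topology
open Literature.Analysis.FluidPDE

namespace NoConicalEulerFlux

variable {U : EuclideanSpace ℝ (Fin 3) → EuclideanSpace ℝ (Fin 3)} {P : EuclideanSpace ℝ (Fin 3) → ℝ}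

/-! ### Test functions supported off the origin -/

/-- A smooth test function with `0 ∉ tsupport θ` is `C¹`, vanishes near `0`, and so does its
derivative. [folklore] -/
theorem testFn_aux {θ : EuclideanSpace ℝ (Fin 3) → ℝ} (hθ : ContDiff ℝ (⊤ : ℕ∞) θ)
    (hθ0 : (0 : EuclideanSpace ℝ (Fin 3)) ∉ tsupport θ) :
    ContDiff ℝ 1 θ ∧ θ =ᶠ[𝓝 0] 0 ∧ fderiv ℝ θ =ᶠ[𝓝 0] 0 := by
  have hθz : θ =ᶠ[𝓝 0] 0 := notMem_tsupport_iff_eventuallyEq.mp hθ0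
  refine ⟨hθ.of_le (by exact_mod_cast le_top), hθz, ?_⟩
  filter_upwards [eventually_eventually_nhds.mpr hθz] with y hy
  rw [Filter.EventuallyEq.fderiv_eq (hy : θ =ᶠ[𝓝 y] 0)]
  simp

/-- `⟪w, ∇θ x⟫ = Dθ(x) w`. [folklore] -/
theorem inner_gradient_right (θ : EuclideanSpace ℝ (Fin 3) → ℝ) (x w : EuclideanSpace ℝ (Fin 3)) :
    ⟪w, gradient θ x⟫ = fderiv ℝ θ x w := by
  rw [real_inner_comm, Shvydkoy2018.inner_gradient_left]

/-- `div (θ U) = θ div U + ⟪U, ∇θ⟫` everywhere, when `U` is `C¹` off `0` and `θ` is a test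
function vanishing near `0` (at `x = 0` both sides vanish). [folklore] -/
theorem divergence_smul_eq (hU : ContDiffOn ℝ 1 U {x | x ≠ 0}) {θ : EuclideanSpace ℝ (Fin 3) → ℝ}
    (hθ : ContDiff ℝ (⊤ : ℕ∞) θ) (hθ0 : (0 : EuclideanSpace ℝ (Fin 3)) ∉ tsupport θ)
    (x : EuclideanSpace ℝ (Fin 3)) :
    VectorCalculus.divergence (fun y => θ y • U y) x =
      θ x * VectorCalculus.divergence U x + ⟪U x, gradient θ x⟫ := by
  obtain ⟨hθ1, hθz, hDθz⟩ := testFn_aux hθ hθ0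
  rcases eq_or_ne x 0 with rfl | hx
  · have hW0 : (fun y => θ y • U y) =ᶠ[𝓝 (0 : EuclideanSpace ℝ (Fin 3))] 0 := by
      filter_upwards [hθz] with y hy
      simp [hy]
    have h1 : fderiv ℝ (fun y => θ y • U y) 0 = 0 := by
      rw [Filter.EventuallyEq.fderiv_eq hW0]
      simp
    have h2 : θ 0 = 0 := hθz.eq_of_nhds
    have h3 : fderiv ℝ θ 0 = 0 := hDθz.eq_of_nhds
    rw [inner_gradient_right, h3, h2, VectorCalculus.divergence, h1]
    simp
  · rw [Shvydkoy2018.divergence_smul_apply (stdOrthonormalBasis ℝ (EuclideanSpace ℝ (Fin 3)))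
        (hθ1.differentiable one_ne_zero x)
        ((hU.differentiableOn one_ne_zero).differentiableAt (isOpen_ne.mem_nhds hx)),
      inner_gradient_right]

/-! ### Weak ⇒ strong off the origin for `C¹` fields -/

/-- **Weakly divergence-free `C¹` fields are divergence free off the origin.** If `U` is `C¹` on
`ℝ³ ∖ {0}` and `∫ ⟪U, ∇θ⟫ = 0` for every smooth compactly supported `θ` with
`0 ∉ tsupport θ`, then `div U (x) = 0` for every `x ≠ 0` (integration by parts off the origin,
du Bois-Reymond lemma, continuity of `div U` on the open set `{x ≠ 0}`). [folklore] -/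
theorem divergence_eq_zero_of_weak (hU : ContDiffOn ℝ 1 U {x | x ≠ 0})
    (hweak : ∀ θ : EuclideanSpace ℝ (Fin 3) → ℝ, ContDiff ℝ (⊤ : ℕ∞) θ → HasCompactSupport θ →
      (0 : EuclideanSpace ℝ (Fin 3)) ∉ tsupport θ → ∫ x, ⟪U x, gradient θ x⟫ = 0) :
    ∀ ⦃x : EuclideanSpace ℝ (Fin 3)⦄, x ≠ 0 → VectorCalculus.divergence U x = 0 := by
  set b := stdOrthonormalBasis ℝ (EuclideanSpace ℝ (Fin 3))
  -- continuity of `div U` off the origin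
  have hDU : ContinuousOn (fderiv ℝ U) {x | x ≠ 0} :=
    hU.continuousOn_fderiv_of_isOpen isOpen_ne le_rfl
  have hdivc : ContinuousOn (VectorCalculus.divergence U) {x : EuclideanSpace ℝ (Fin 3) | x ≠ 0} := by
    have : VectorCalculus.divergence U = fun x => ∑ i, ⟪b i, fderiv ℝ U x (b i)⟫ :=
      funext fun x => divergence_eq_sum_inner_fderiv b U x
    rw [this]
    exact continuousOn_finsetSum _ fun i _ =>
      continuousOn_const.inner (hDU.clm_apply continuousOn_const)
  -- `∫ θ div U = 0` for every test function supported off the origin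
  have hint : ∀ θ : EuclideanSpace ℝ (Fin 3) → ℝ, ContDiff ℝ (⊤ : ℕ∞) θ → HasCompactSupport θ →
      (0 : EuclideanSpace ℝ (Fin 3)) ∉ tsupport θ →
      ∫ x, θ x * VectorCalculus.divergence U x = 0 := by
    intro θ hθ hθc hθ0
    obtain ⟨hθ1, hθz, hDθz⟩ := testFn_aux hθ hθ0
    have hW : ContDiffOn ℝ 1 (fun y => θ y • U y) {x | x ≠ 0} := hθ1.contDiffOn.smul hU
    have hW0 : (fun y => θ y • U y) =ᶠ[𝓝 (0 : EuclideanSpace ℝ (Fin 3))] 0 := by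
      filter_upwards [hθz] with y hy
      simp [hy]
    have hWc : HasCompactSupport (fun y => θ y • U y) := hθc.smul_right
    have hibp := Shvydkoy2018.integral_fderiv_apply_add_mul_divergence_eq_zero
      volume (G := fun _ => (1 : ℝ)) hW hW0 hWc contDiffOn_const
    simp only [fderiv_fun_const, Pi.zero_apply, zero_apply, one_mul, zero_add] at hibp
    simp_rw [divergence_smul_eq hU hθ hθ0] at hibp
    -- split the integral: both summands are continuous with compact support
    have hI1 : Integrable (fun x => θ x * VectorCalculus.divergence U x) := by
      refine Continuous.integrable_of_hasCompactSupport ?_ hθc.mul_right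
      refine Shvydkoy2018.continuous_of_off_origin (hθ.continuous.continuousOn.mul hdivc) ?_
      filter_upwards [hθz] with y hy
      simp [hy]
    have hI2 : Integrable (fun x => ⟪U x, gradient θ x⟫) := by
      refine Continuous.integrable_of_hasCompactSupport ?_ ?_
      · refine Shvydkoy2018.continuous_of_off_origin (hU.continuousOn.inner ?_) ?_
        · exact ((InnerProductSpace.toDual ℝ (EuclideanSpace ℝ (Fin 3))).symm.continuous.comp
            (hθ1.continuous_fderiv one_ne_zero)).continuousOn
        · filter_upwards [hDθz] with y hy
          rw [inner_gradient_right, hy]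
          simp
      · refine (hθc.fderiv (𝕜 := ℝ)).mono ?_
        intro y hy h0
        apply hy
        simp [h0]
    rw [integral_add hI1 hI2, hweak θ hθ hθc hθ0, add_zero] at hibp
    exact hibp
  -- du Bois-Reymond on the open set `{x ≠ 0}`
  have hae : ∀ᵐ x ∂volume, x ∈ {x : EuclideanSpace ℝ (Fin 3) | x ≠ 0} →
      VectorCalculus.divergence U x = 0 := by
    refine isOpen_ne.ae_eq_zero_of_integral_contDiff_smul_eq_zero
      (hdivc.locallyIntegrableOn isOpen_ne.measurableSet) fun g hg hgc hgs => ?_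
    have hg0 : (0 : EuclideanSpace ℝ (Fin 3)) ∉ tsupport g := fun h => hgs h rfl
    simpa [smul_eq_mul] using hint g hg hgc hg0
  have hae' : VectorCalculus.divergence U =ᵐ[volume.restrict {x | x ≠ 0}] fun _ => (0 : ℝ) :=
    (ae_restrict_iff' isOpen_ne.measurableSet).mpr hae
  intro x hx
  exact Measure.eqOn_open_of_ae_eq hae' isOpen_ne hdivc continuousOn_const hx

/-- **Weak stationary Euler pairs of class `C¹` solve the equations pointwise off the origin.**
If `U`, `P` are `C¹` on `ℝ³ ∖ {0}`, `div U = 0` there, and `∫ (⟪U, DΦ U⟫ + P div Φ) = 0` for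
every smooth compactly supported field `Φ` with `0 ∉ tsupport Φ`, then `(U·∇)U + ∇P = 0` at
every `x ≠ 0` (test with `Φ = θ e`, integrate by parts off the origin, du Bois-Reymond,
continuity). [folklore] -/
theorem momentum_eq_zero_of_weak (hU : ContDiffOn ℝ 1 U {x | x ≠ 0})
    (hP : ContDiffOn ℝ 1 P {x | x ≠ 0})
    (hdiv : ∀ ⦃x : EuclideanSpace ℝ (Fin 3)⦄, x ≠ 0 → VectorCalculus.divergence U x = 0)
    (hweak : ∀ Φ : EuclideanSpace ℝ (Fin 3) → EuclideanSpace ℝ (Fin 3), ContDiff ℝ (⊤ : ℕ∞) Φ →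
      HasCompactSupport Φ → (0 : EuclideanSpace ℝ (Fin 3)) ∉ tsupport Φ →
      ∫ x, (⟪U x, fderiv ℝ Φ x (U x)⟫ + P x * VectorCalculus.divergence Φ x) = 0) :
    ∀ ⦃x : EuclideanSpace ℝ (Fin 3)⦄, x ≠ 0 → convect U U x + gradient P x = 0 := by
  have hUc : ContinuousOn U {x : EuclideanSpace ℝ (Fin 3) | x ≠ 0} := hU.continuousOn
  have hDU : ContinuousOn (fderiv ℝ U) {x | x ≠ 0} :=
    hU.continuousOn_fderiv_of_isOpen isOpen_ne le_rfl
  have hDP : ContinuousOn (fderiv ℝ P) {x | x ≠ 0} :=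
    hP.continuousOn_fderiv_of_isOpen isOpen_ne le_rfl
  have hgradP : ContinuousOn (gradient P) {x : EuclideanSpace ℝ (Fin 3) | x ≠ 0} :=
    (InnerProductSpace.toDual ℝ (EuclideanSpace ℝ (Fin 3))).symm.continuous.comp_continuousOn hDP
  -- the residual `R = (U·∇)U + ∇P` is continuous off the origin
  have hRc : ContinuousOn (fun x => convect U U x + gradient P x)
      {x : EuclideanSpace ℝ (Fin 3) | x ≠ 0} := by
    refine ContinuousOn.add ?_ hgradP
    show ContinuousOn (fun x => fderiv ℝ U x (U x)) {x : EuclideanSpace ℝ (Fin 3) | x ≠ 0}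
    exact hDU.clm_apply hUc
  -- `∫ θ ⟪R, e⟫ = 0` for every test function `θ` off the origin and every vector `e`
  have hint : ∀ (e : EuclideanSpace ℝ (Fin 3)) (θ : EuclideanSpace ℝ (Fin 3) → ℝ),
      ContDiff ℝ (⊤ : ℕ∞) θ → HasCompactSupport θ → (0 : EuclideanSpace ℝ (Fin 3)) ∉ tsupport θ →
      ∫ x, θ x * ⟪convect U U x + gradient P x, e⟫ = 0 := by
    intro e θ hθ hθc hθ0
    obtain ⟨hθ1, hθz, hDθz⟩ := testFn_aux hθ hθ0
    -- the test field `Φ = θ e`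
    have hΦ : ContDiff ℝ (⊤ : ℕ∞) (fun y => θ y • e) := hθ.smul contDiff_const
    have hΦc : HasCompactSupport (fun y => θ y • e) := hθc.smul_right
    have hΦz : (fun y => θ y • e) =ᶠ[𝓝 (0 : EuclideanSpace ℝ (Fin 3))] 0 := by
      filter_upwards [hθz] with y hy
      simp [hy]
    have hΦ0 : (0 : EuclideanSpace ℝ (Fin 3)) ∉ tsupport (fun y => θ y • e) :=
      notMem_tsupport_iff_eventuallyEq.mpr hΦz
    have hDΦ : ∀ y, fderiv ℝ (fun y => θ y • e) y = (fderiv ℝ θ y).smulRight e := fun y =>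
      ((hθ1.differentiable one_ne_zero y).hasFDerivAt.smul_const e).fderiv
    have hdivΦ : ∀ y, VectorCalculus.divergence (fun y => θ y • e) y = fderiv ℝ θ y e := by
      intro y
      rw [VectorCalculus.divergence, hDΦ y, ContinuousLinearMap.coe_smulRight,
        LinearMap.trace_smulRight]
      rfl
    have hw := hweak _ hΦ hΦc hΦ0
    simp_rw [hDΦ, hdivΦ, ContinuousLinearMap.smulRight_apply, inner_smul_right] at hw
    -- first integration by parts: `G = ⟪U, e⟫`, `W = θ U`
    have hW : ContDiffOn ℝ 1 (fun y => θ y • U y) {x | x ≠ 0} := hθ1.contDiffOn.smul hU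
    have hW0 : (fun y => θ y • U y) =ᶠ[𝓝 (0 : EuclideanSpace ℝ (Fin 3))] 0 := by
      filter_upwards [hθz] with y hy
      simp [hy]
    have hWc : HasCompactSupport (fun y => θ y • U y) := hθc.smul_right
    have hG : ContDiffOn ℝ 1 (fun y => ⟪U y, e⟫) {x : EuclideanSpace ℝ (Fin 3) | x ≠ 0} :=
      hU.inner ℝ contDiffOn_const
    have hibp1 :=
      Shvydkoy2018.integral_fderiv_apply_add_mul_divergence_eq_zero volume hW hW0 hWc hG
    -- rewrite its integrand pointwise
    have hexp1 : ∀ x, fderiv ℝ (fun y => ⟪U y, e⟫) x (θ x • U x)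
        + ⟪U x, e⟫ * VectorCalculus.divergence (fun y => θ y • U y) x
        = θ x * ⟪convect U U x, e⟫ + ⟪U x, e⟫ * fderiv ℝ θ x (U x) := by
      intro x
      rcases eq_or_ne x 0 with rfl | hx
      · have h2 : θ 0 = 0 := hθz.eq_of_nhds
        have h3 : fderiv ℝ θ 0 = 0 := hDθz.eq_of_nhds
        have h1 : fderiv ℝ (fun y => θ y • U y) 0 = 0 := by
          rw [Filter.EventuallyEq.fderiv_eq hW0]
          simp
        simp [VectorCalculus.divergence, h1, h2, h3]
      · have hUd : DifferentiableAt ℝ U x :=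
          (hU.differentiableOn one_ne_zero).differentiableAt (isOpen_ne.mem_nhds hx)
        have hGd : fderiv ℝ (fun y => ⟪U y, e⟫) x = (innerSL ℝ e).comp (fderiv ℝ U x) := by
          rw [(hUd.hasFDerivAt.inner ℝ (hasFDerivAt_const e x)).fderiv]
          ext w
          simp [real_inner_comm]
        rw [divergence_smul_eq hU hθ hθ0, hdiv hx, hGd, inner_gradient_right]
        simp only [ContinuousLinearMap.comp_apply, map_smul, innerSL_apply_apply, smul_eq_mul,
          convect_apply, mul_zero, zero_add]
        rw [real_inner_comm]
    simp_rw [hexp1] at hibp1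
    -- second integration by parts: `G = P`, `W = θ e`
    have hW' : ContDiffOn ℝ 1 (fun y => θ y • e) {x : EuclideanSpace ℝ (Fin 3) | x ≠ 0} :=
      (hθ1.smul contDiff_const).contDiffOn
    have hibp2 :=
      Shvydkoy2018.integral_fderiv_apply_add_mul_divergence_eq_zero volume hW' hΦz hΦc hP
    have hexp2 : ∀ x,
        fderiv ℝ P x (θ x • e) + P x * VectorCalculus.divergence (fun y => θ y • e) x
          = θ x * ⟪gradient P x, e⟫ + P x * fderiv ℝ θ x e := by
      intro x
      rw [hdivΦ, map_smul, smul_eq_mul, Shvydkoy2018.inner_gradient_left]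
    simp_rw [hexp2] at hibp2
    -- integrability of the four summands (continuous, compactly supported)
    have hcs : ∀ {g : EuclideanSpace ℝ (Fin 3) → ℝ}, ContinuousOn g {x | x ≠ 0} →
        Integrable (fun x => θ x * g x) := by
      intro g hg
      refine Continuous.integrable_of_hasCompactSupport ?_ hθc.mul_right
      refine Shvydkoy2018.continuous_of_off_origin (hθ.continuous.continuousOn.mul hg) ?_
      filter_upwards [hθz] with y hy
      simp [hy]
    have hIa : Integrable (fun x => θ x * ⟪convect U U x, e⟫) := by
      refine hcs ?_
      show ContinuousOn (fun x => ⟪fderiv ℝ U x (U x), e⟫) {x : EuclideanSpace ℝ (Fin 3) | x ≠ 0}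
      exact (hDU.clm_apply hUc).inner continuousOn_const
    have hIb : Integrable (fun x => ⟪U x, e⟫ * fderiv ℝ θ x (U x)) := by
      refine Continuous.integrable_of_hasCompactSupport ?_ ?_
      · refine Shvydkoy2018.continuous_of_off_origin ((hUc.inner continuousOn_const).mul
            ((hθ1.continuous_fderiv one_ne_zero).continuousOn.clm_apply hUc)) ?_
        filter_upwards [hDθz] with y hy
        simp [hy]
      · refine (hθc.fderiv (𝕜 := ℝ)).mono ?_
        intro y hy h0
        apply hy
        simp [h0]
    have hIc : Integrable (fun x => θ x * ⟪gradient P x, e⟫) :=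
      hcs (hgradP.inner continuousOn_const)
    have hId : Integrable (fun x => P x * fderiv ℝ θ x e) := by
      refine Continuous.integrable_of_hasCompactSupport ?_ ?_
      · refine Shvydkoy2018.continuous_of_off_origin (hP.continuousOn.mul
            ((hθ1.continuous_fderiv one_ne_zero).clm_apply continuous_const).continuousOn) ?_
        filter_upwards [hDθz] with y hy
        simp [hy]
      · refine (hθc.fderiv_apply (𝕜 := ℝ) e).mono ?_
        intro y hy h0
        apply hy
        simp [h0]
    rw [integral_add hIa hIb] at hibp1
    rw [integral_add hIc hId] at hibp2
    have hw' : ∫ x, (fderiv ℝ θ x (U x) * ⟪U x, e⟫ + P x * fderiv ℝ θ x e) =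
        (∫ x, ⟪U x, e⟫ * fderiv ℝ θ x (U x)) + ∫ x, P x * fderiv ℝ θ x e := by
      rw [← integral_add hIb hId]
      refine integral_congr_ae (Eventually.of_forall fun x => ?_)
      ring
    have hsum : ∫ x, θ x * ⟪convect U U x + gradient P x, e⟫ =
        (∫ x, θ x * ⟪convect U U x, e⟫) + ∫ x, θ x * ⟪gradient P x, e⟫ := by
      rw [← integral_add hIa hIc]
      refine integral_congr_ae (Eventually.of_forall fun x => ?_)
      simp only [inner_add_left, mul_add]
    rw [hsum]
    linarith
  -- du Bois-Reymond componentwise, then continuity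
  intro x hx
  refine ext_inner_right ℝ fun e => ?_
  rw [inner_zero_left]
  have hRe : ContinuousOn (fun x => ⟪convect U U x + gradient P x, e⟫)
      {x : EuclideanSpace ℝ (Fin 3) | x ≠ 0} :=
    hRc.inner continuousOn_const
  have hae : ∀ᵐ y ∂volume, y ∈ {x : EuclideanSpace ℝ (Fin 3) | x ≠ 0} →
      ⟪convect U U y + gradient P y, e⟫ = 0 := by
    refine isOpen_ne.ae_eq_zero_of_integral_contDiff_smul_eq_zero
      (hRe.locallyIntegrableOn isOpen_ne.measurableSet) fun g hg hgc hgs => ?_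
    have hg0 : (0 : EuclideanSpace ℝ (Fin 3)) ∉ tsupport g := fun h => hgs h rfl
    simpa [smul_eq_mul] using hint e g hg hgc hg0
  have hae' : (fun y => ⟪convect U U y + gradient P y, e⟫)
      =ᵐ[volume.restrict {x | x ≠ 0}] fun _ => (0 : ℝ) :=
    (ae_restrict_iff' isOpen_ne.measurableSet).mpr hae
  exact Measure.eqOn_open_of_ae_eq hae' isOpen_ne hRe continuousOn_const hx

end NoConicalEulerFlux

open NoConicalEulerFlux in
/-- **The `C¹` case of `NoConicalEulerFlux`** (helper for stmt-AnomalousDissipation-1547): for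
`U : ℝ³ → ℝ³`, `P : ℝ³ → ℝ` of class `C¹` on `ℝ³ ∖ {0}`, homogeneous of degrees `-1` and `-2`
(`U (c x) = c⁻¹ U x`, `P (c x) = c⁻² P x`, `c > 0`), weakly divergence free and a weak
stationary Euler pair against smooth tests supported off the origin, the momentum flux through
spheres vanishes: `∫ (⟪U, ∇χ̃⟫ U + P ∇χ̃) = 0` for every smooth radial cut-off `χ̃ = χ ∘ ‖·‖`,
`χ = 1` on `r ≤ 1`, `χ = 0` on `r ≥ 2`. Indeed the weak identities upgrade to pointwise ones
off the origin (`divergence_eq_zero_of_weak`, `momentum_eq_zero_of_weak`), Shvydkoy 2018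
Prop. 2.1 (`shvydkoy_homogeneousSteadyEuler_alpha_one_holds`, proved in the tree) gives `U = 0`,
`P = 0` off the origin, the homogeneity clauses at `x = 0` give `U 0 = 0`, `P 0 = 0`, and the
integrand is identically zero. The item itself asks for `ContinuousOn` in place of
`ContDiffOn ℝ 1`; this is its `C¹` shadow. [cite: Shvydkoy2018, Prop. 2.1] -/
theorem noConicalEulerFlux_of_contDiffOn :
    ∀ (U : EuclideanSpace ℝ (Fin 3) → EuclideanSpace ℝ (Fin 3)) (P : EuclideanSpace ℝ (Fin 3) → ℝ),
    ContDiffOn ℝ 1 U {x | x ≠ 0} → ContDiffOn ℝ 1 P {x | x ≠ 0} →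
    (∀ (c : ℝ) (x : EuclideanSpace ℝ (Fin 3)), 0 < c → U (c • x) = c⁻¹ • U x) →
    (∀ (c : ℝ) (x : EuclideanSpace ℝ (Fin 3)), 0 < c → P (c • x) = (c ^ 2)⁻¹ * P x) →
    (∀ θ : EuclideanSpace ℝ (Fin 3) → ℝ, ContDiff ℝ (⊤ : ℕ∞) θ → HasCompactSupport θ →
      (0 : EuclideanSpace ℝ (Fin 3)) ∉ tsupport θ →
      MeasureTheory.integral MeasureTheory.volume (fun x => inner ℝ (U x) (gradient θ x)) = 0) →
    (∀ Φ : EuclideanSpace ℝ (Fin 3) → EuclideanSpace ℝ (Fin 3), ContDiff ℝ (⊤ : ℕ∞) Φ →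
      HasCompactSupport Φ → (0 : EuclideanSpace ℝ (Fin 3)) ∉ tsupport Φ →
      MeasureTheory.integral MeasureTheory.volume (fun x => inner ℝ (U x) (fderiv ℝ Φ x (U x))
        + P x * Literature.Analysis.FluidPDE.VectorCalculus.divergence Φ x) = 0) →
    ∀ χ : ℝ → ℝ, ContDiff ℝ (⊤ : ℕ∞) χ → (∀ r, r ≤ 1 → χ r = 1) → (∀ r, 2 ≤ r → χ r = 0) →
    MeasureTheory.integral MeasureTheory.volume (fun x =>
      inner ℝ (U x) (gradient (fun y : EuclideanSpace ℝ (Fin 3) => χ ‖y‖) x) • U x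
        + P x • gradient (fun y : EuclideanSpace ℝ (Fin 3) => χ ‖y‖) x) = 0 := by
  intro U P hU hP hUs hPs hdivw hmomw χ _ _ _
  have hdiv := divergence_eq_zero_of_weak hU hdivw
  have hmom := momentum_eq_zero_of_weak hU hP hdiv hmomw
  have hzero : ∀ ⦃x : EuclideanSpace ℝ (Fin 3)⦄, x ≠ 0 → U x = 0 ∧ P x = 0 := fun x hx =>
    shvydkoy_homogeneousSteadyEuler_alpha_one_holds.eq_zero hU hP
      (fun c hc x _ => hUs c x hc) (fun c hc x _ => hPs c x hc) hdiv hmom hx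
  have hU0 : U 0 = 0 := by
    have h := hUs 2 0 two_pos
    rw [smul_zero] at h
    have h2 : (2 : ℝ) • U 0 = U 0 := by
      conv_lhs => rw [h]
      rw [smul_smul]
      norm_num
    rw [two_smul] at h2
    simpa using h2
  have hP0 : P 0 = 0 := by
    have h := hPs 2 0 two_pos
    rw [smul_zero] at h
    linarith
  have hUz : ∀ x, U x = 0 := fun x => by
    rcases eq_or_ne x 0 with rfl | hx
    exacts [hU0, (hzero hx).1]
  have hPz : ∀ x, P x = 0 := fun x => by
    rcases eq_or_ne x 0 with rfl | hx
    exacts [hP0, (hzero hx).2]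
  simp [hUz, hPz]

end Summit.AnomalousDissipation.AnomalousDissipation.Theorems
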